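import Mathlib
import Summits.Ventures.PercRepro2.Defs
import Summits.Ventures.PercRepro2.Independence
import Summits.Ventures.PercRepro2.Harris
import Summits.Ventures.PercRepro2.Graph
import Summits.Ventures.PercRepro2.Exploration
import Summits.Ventures.PercRepro2.Events
import Summits.Ventures.PercRepro2.FourFunctions
import Summits.Ventures.PercRepro2.Induced
import Summits.Ventures.PercRepro2.Frontier
import Summits.Ventures.PercRepro2.ObsIndependence
import Summits.Ventures.PercRepro2.BHK
import Summits.Ventures.PercRepro2.BHKEvents
import Summits.Ventures.PercRepro2.MultiSource
import Summits.Ventures.PercRepro2.OrderPreservation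
import Summits.Ventures.PercRepro2.SeedSet
import Summits.Ventures.PercRepro2.MultiSourceFun
import Summits.Ventures.PercRepro2.CrossRootT
import Summits.Ventures.PercRepro2.VdBKahn
import Summits.Ventures.PercRepro2.HullDefs
import Summits.Ventures.PercRepro2.CCTRootEdge
import Summits.Ventures.PercRepro2.CCTAvoidedEdge
import Summits.Ventures.PercRepro2.R1Rung
import Summits.Ventures.PercRepro2.CC2Rung
import Summits.Ventures.PercRepro2.PASubDefs
import Summits.Ventures.PercRepro2.HalfN
import Summits.Ventures.PercRepro2.CCTLin
import Summits.Ventures.PercRepro2.L1SDefs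
import Summits.Ventures.PercRepro2.L1SDel
import Summits.Ventures.PercRepro2.L1S
import Summits.Ventures.PercRepro2.OneEdge
import Summits.Ventures.PercRepro2.CCTMinusFrameDefs

/-!
# (CC-T⁻) in the S-frame: the reweighting form (blind cell PercRepro2, typer-1; mine-c g3
MINE-C.md §10.6 (c) "(CC-T⁻) ⟺ E_ν[(x − m)(y − m)·1[u ∈ S]·q̃_w(S)] ≤ Cov_ν(x, y) with
q̃_w(S) = P_{G−S}(w ↔ T) (0 if w ∈ S), a DECREASING function of S … the joint law of the two
clusters (C(s), C(w)) is load-bearing")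

`S = C_{ω⁻}(s)` is the `e`-closed cluster of the root, `ν(W) = P(R⁻ ∩ {S = W})` its law on the
`e`-closed avoidance `R⁻ = {S ∩ T = ∅}`, `x(W) = 1[a ∈ W]`, `y(W) = 1[b ∈ W]`, and for `e = {u, w}`

`κ(W) = 1[u ∈ W] · P(C_{G−W}(w) hits T) + 1[w ∈ W] · P(C_{G−W}(u) hits T)`

is the conditional probability that `e` is pivotal for `s ↔ T` given `S = W` (`hitDel`): exactly
one end of `e` is in `S` and the other end's cluster in `G − S` reaches `T`
(`notMem_Rplus_iff_of_SEvent`, from `OneEdge.conn_update_true_iff`; independence of the `G − W`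
events from `{S = W}`). Hence

* **`prob_Rplus_inter_SEvent_eq`**: `P(R⁺ ∩ {S = W}) = ν(W) · (1 − κ(W))`, and
* **`CCTMinus_iff_reweight`**: (CC-T⁻) `⟺`
  `Σ_W ν(W) κ(W) (P₀ x(W) − F₀ᵃ)(P₀ y(W) − F₀ᵇ) ≤ P₀ (P₀ Σ_W ν(W) x(W) y(W) − F₀ᵃ F₀ᵇ)`
  (`CCTMinusReweight`; `P₀ = Σ ν`, `F₀ᵃ = Σ ν x`, `F₀ᵇ = Σ ν y`): the pivotal reweighting of the
  centred product is dominated by the covariance — mine-c's form with both pivotal terms.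
-/

namespace Summit.Ventures.PercRepro2

namespace SFrame

open PASub CCTLin TwoSetRung OneEdge

open scoped Classical

variable {V : Type*} {E : Type*} [Fintype E] [DecidableEq E] [Fintype V] [DecidableEq V]
  {R : Type*} [Field R] [LinearOrder R] [IsStrictOrderedRing R]

/-! ## The law of `S` on `R⁻` and the pivotal weight -/

section Probability

variable (p : E → R) (ends : E → Sym2 V) (e : E) (s : V) (T : Finset V)

/-- `ν(W) = P(R⁻ ∩ {S = W})`. -/
noncomputable def nu (W : Set V) : R := prob p (Rminus ends e s T ∩ SEvent ends e s W)

/-- The pivotal weight `κ(W) = 1[u ∈ W] P(C_{G−W}(w) hits T) + 1[w ∈ W] P(C_{G−W}(u) hits T)`. -/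
noncomputable def kappa (u w : V) (W : Set V) : R :=
  (if u ∈ W then prob p (hitDel ends T W w) else 0) +
    (if w ∈ W then prob p (hitDel ends T W u) else 0)

omit [Fintype V] [DecidableEq V] [LinearOrder R] [IsStrictOrderedRing R] in
/-- `P₀ = P(R⁻)`. -/
lemma massP_zero_eq : massP (Function.update p e 0) ends s T = prob p (Rminus ends e s T) := by
  unfold massP
  rw [CCT.prob_update_zero_eq]
  rfl

omit [Fintype V] [DecidableEq V] [LinearOrder R] [IsStrictOrderedRing R] in
/-- `F₀ᵃ = P(X⁻ ∩ R⁻)`. -/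
lemma massF_zero_eq (a : V) :
    massF (Function.update p e 0) ends s {a} T = prob p (Xminus ends e s a ∩ Rminus ends e s T) := by
  unfold massF
  rw [CCT.prob_update_zero_eq]
  congr 1
  ext ω
  simp only [Set.mem_setOf_eq, Set.mem_inter_iff, connAll, Finset.mem_singleton, forall_eq,
    Xminus, Rminus]
  tauto

omit [Fintype E] [LinearOrder R] [IsStrictOrderedRing R] in
/-- `R⁻ ∩ {S = W}` is `{S = W}` if `W ∩ T = ∅` and empty otherwise. -/
lemma Rminus_inter_SEvent_eq (W : Set V) :
    Rminus ends e s T ∩ SEvent ends e s W =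
      if ∀ t ∈ T, t ∉ W then SEvent ends e s W else ∅ := by
  ext ω
  split_ifs with hT
  · simp only [Set.mem_inter_iff]
    constructor
    · exact And.right
    · intro hS
      exact ⟨(mem_Rminus_iff_of_SEvent ends e s T hS).2 hT, hS⟩
  · simp only [Set.mem_inter_iff, Set.mem_empty_iff_false, iff_false, not_and]
    intro hR hS
    exact hT ((mem_Rminus_iff_of_SEvent ends e s T hS).1 hR)

omit [LinearOrder R] [IsStrictOrderedRing R] in
/-- **`P(R⁺ ∩ {S = W}) = ν(W) (1 − κ(W))`** for `e = {u, w}`. -/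
theorem prob_Rplus_inter_SEvent_eq {u w : V} (hends : ends e = s(u, w))
    (W : Set V) :
    prob p (Rplus ends e s T ∩ SEvent ends e s W) =
      nu p ends e s T W * (1 - kappa p ends T u w W) := by
  unfold nu kappa
  by_cases hT : ∀ t ∈ T, t ∉ W
  · rw [Rminus_inter_SEvent_eq, if_pos hT]
    -- on `{S = W}`: `R⁺` is the complement of the pivotal event
    have hset : Rplus ends e s T ∩ SEvent ends e s W =
        ((if u ∈ W then hitDel ends T W w else ∅) ∪ (if w ∈ W then hitDel ends T W u else ∅))ᶜ ∩
          SEvent ends e s W := by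
      ext ω
      simp only [Set.mem_inter_iff, Set.mem_compl_iff, Set.mem_union]
      constructor
      · rintro ⟨hR, hS⟩
        refine ⟨?_, hS⟩
        intro h
        apply (notMem_Rplus_iff_of_SEvent ends e s T hends hS hT).2 _ hR
        rcases h with h | h
        · split_ifs at h with hu
          · exact Or.inl ⟨hu, h⟩
          · exact absurd h (Set.notMem_empty ω)
        · split_ifs at h with hw
          · exact Or.inr ⟨hw, h⟩
          · exact absurd h (Set.notMem_empty ω)
      · rintro ⟨hn, hS⟩
        refine ⟨?_, hS⟩
        by_contra hR
        rcases (notMem_Rplus_iff_of_SEvent ends e s T hends hS hT).1 hR with ⟨hu, h⟩ | ⟨hw, h⟩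
        · exact hn (Or.inl (by rw [if_pos hu]; exact h))
        · exact hn (Or.inr (by rw [if_pos hw]; exact h))
    rw [hset]
    -- the pivotal event depends on the edges off `W`: independence from `{S = W}`
    have hdep : DependsOn (· ∈ ((if u ∈ W then hitDel ends T W w else ∅) ∪
        (if w ∈ W then hitDel ends T W u else ∅))ᶜ) (touches ends W)ᶜ := by
      refine dependsOn_compl ?_
      have h1 : DependsOn (· ∈ (if u ∈ W then hitDel ends T W w else ∅)) (touches ends W)ᶜ := by
        split_ifs
        · exact dependsOn_hitDel ends T W w
        · intro ω ω' _; rfl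
      have h2 : DependsOn (· ∈ (if w ∈ W then hitDel ends T W u else ∅)) (touches ends W)ᶜ := by
        split_ifs
        · exact dependsOn_hitDel ends T W u
        · intro ω ω' _; rfl
      have h := dependsOn_union h1 h2
      rwa [Set.union_self] at h
    rw [prob_inter_SEvent_eq_mul p ends e s hdep, prob_compl, mul_comm]
    congr 2
    -- the two pivotal events are disjoint (both empty when both ends lie in `W`)
    split_ifs with hu hw
    · rw [hitDel_eq_empty_of_mem ends T hw hT, hitDel_eq_empty_of_mem ends T hu hT]
      simp
    · simp
    · simp
    · simp
  · -- `W` meets `T`: both sides vanish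
    obtain ⟨t, ht, htW⟩ : ∃ t ∈ T, t ∈ W := by
      by_contra hcon
      exact hT fun t ht htW => hcon ⟨t, ht, htW⟩
    rw [Rplus_inter_SEvent_eq_empty ends e s ht htW, Rminus_inter_SEvent_eq, if_neg hT, prob_empty,
      zero_mul]

omit [Fintype V] [DecidableEq V] [LinearOrder R] [IsStrictOrderedRing R] in
/-- `P(A ∩ R⁺ ∩ {S = W}) = 1[A(W)] · P(R⁺ ∩ {S = W})` for `A = X⁻ₐ`. -/
lemma prob_Xminus_inter_Rplus_inter_SEvent (a : V) (W : Set V) :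
    prob p (Xminus ends e s a ∩ Rplus ends e s T ∩ SEvent ends e s W) =
      (if a ∈ W then 1 else 0) * prob p (Rplus ends e s T ∩ SEvent ends e s W) := by
  split_ifs with ha
  · rw [one_mul]
    congr 1
    ext ω
    simp only [Set.mem_inter_iff]
    constructor
    · rintro ⟨⟨_, hR⟩, hS⟩; exact ⟨hR, hS⟩
    · rintro ⟨hR, hS⟩
      exact ⟨⟨(mem_Xminus_iff_of_SEvent ends e s hS a).2 ha, hR⟩, hS⟩
  · rw [zero_mul]
    convert prob_empty p
    ext ω
    simp only [Set.mem_inter_iff, Set.mem_empty_iff_false, iff_false, not_and]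
    intro hXR hS
    exact ha ((mem_Xminus_iff_of_SEvent ends e s hS a).1 hXR.1)

omit [Fintype V] [DecidableEq V] [LinearOrder R] [IsStrictOrderedRing R] in
/-- The pair version. -/
lemma prob_Xminus_inter_Xminus_inter_Rplus_inter_SEvent (a b : V) (W : Set V) :
    prob p (Xminus ends e s a ∩ Xminus ends e s b ∩ Rplus ends e s T ∩ SEvent ends e s W) =
      (if a ∈ W then 1 else 0) * ((if b ∈ W then 1 else 0) *
        prob p (Rplus ends e s T ∩ SEvent ends e s W)) := by
  rw [← prob_Xminus_inter_Rplus_inter_SEvent]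
  split_ifs with ha
  · rw [one_mul]
    congr 1
    ext ω
    simp only [Set.mem_inter_iff]
    constructor
    · rintro ⟨⟨⟨_, hb⟩, hR⟩, hS⟩; exact ⟨⟨hb, hR⟩, hS⟩
    · rintro ⟨⟨hb, hR⟩, hS⟩
      exact ⟨⟨⟨(mem_Xminus_iff_of_SEvent ends e s hS a).2 ha, hb⟩, hR⟩, hS⟩
  · rw [zero_mul]
    convert prob_empty p
    ext ω
    simp only [Set.mem_inter_iff, Set.mem_empty_iff_false, iff_false, not_and]
    intro hXYR hS
    exact ha ((mem_Xminus_iff_of_SEvent ends e s hS a).1 hXYR.1.1)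

omit [Fintype V] [DecidableEq V] [LinearOrder R] [IsStrictOrderedRing R] in
/-- `P(X⁻ₐ ∩ R⁻ ∩ {S = W}) = 1[a ∈ W] ν(W)`. -/
lemma prob_Xminus_inter_Rminus_inter_SEvent (a : V) (W : Set V) :
    prob p (Xminus ends e s a ∩ Rminus ends e s T ∩ SEvent ends e s W) =
      (if a ∈ W then 1 else 0) * nu p ends e s T W := by
  unfold nu
  split_ifs with ha
  · rw [one_mul]
    congr 1
    ext ω
    simp only [Set.mem_inter_iff]
    constructor
    · rintro ⟨⟨_, hR⟩, hS⟩; exact ⟨hR, hS⟩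
    · rintro ⟨hR, hS⟩
      exact ⟨⟨(mem_Xminus_iff_of_SEvent ends e s hS a).2 ha, hR⟩, hS⟩
  · rw [zero_mul]
    convert prob_empty p
    ext ω
    simp only [Set.mem_inter_iff, Set.mem_empty_iff_false, iff_false, not_and]
    intro hXR hS
    exact ha ((mem_Xminus_iff_of_SEvent ends e s hS a).1 hXR.1)

end Probability

/-! ## The reweighting form -/

section Reweight

variable (p : E → R) (ends : E → Sym2 V) (e : E) (s : V) (T : Finset V)

/-- **mine-c's reweighting form of (CC-T⁻)** (§10.6 (c), both pivotal terms):
`Σ_W ν(W) κ(W) (P₀ x(W) − F₀ᵃ)(P₀ y(W) − F₀ᵇ) ≤ P₀ (P₀ Σ_W ν(W) x(W) y(W) − F₀ᵃ F₀ᵇ)`. -/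
def CCTMinusReweight (u w a b : V) : Prop :=
  ∑ W : Set V, nu p ends e s T W * kappa p ends T u w W *
      ((massP (Function.update p e 0) ends s T * (if a ∈ W then 1 else 0) -
          massF (Function.update p e 0) ends s {a} T) *
        (massP (Function.update p e 0) ends s T * (if b ∈ W then 1 else 0) -
          massF (Function.update p e 0) ends s {b} T)) ≤
    massP (Function.update p e 0) ends s T *
      (massP (Function.update p e 0) ends s T *
          (∑ W : Set V, nu p ends e s T W * ((if a ∈ W then 1 else 0) * (if b ∈ W then 1 else 0))) -
        massF (Function.update p e 0) ends s {a} T * massF (Function.update p e 0) ends s {b} T)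

/-- **(CC-T⁻) ⟺ the reweighting form**, for `e = {u, w}`. -/
theorem CCTMinus_iff_reweight {u w : V} (hends : ends e = s(u, w)) (a b : V) :
    CCTMinus p ends e s T a b ↔ CCTMinusReweight p ends e s T u w a b := by
  unfold CCTMinus CCTMinusReweight
  -- the `R⁺`-masses through the partition by `S`
  have hXY : prob p (Xminus ends e s a ∩ Xminus ends e s b ∩ Rplus ends e s T) =
      ∑ W : Set V, nu p ends e s T W * ((if a ∈ W then 1 else 0) * (if b ∈ W then 1 else 0)) *
        (1 - kappa p ends T u w W) := by
    rw [prob_eq_sum_SEvent p ends e s]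
    refine Finset.sum_congr rfl fun W _ => ?_
    rw [prob_Xminus_inter_Xminus_inter_Rplus_inter_SEvent, prob_Rplus_inter_SEvent_eq p ends e s T
      hends]
    ring
  have hX : ∀ c : V, prob p (Xminus ends e s c ∩ Rplus ends e s T) =
      ∑ W : Set V, nu p ends e s T W * (if c ∈ W then 1 else 0) *
        (1 - kappa p ends T u w W) := by
    intro c
    rw [prob_eq_sum_SEvent p ends e s]
    refine Finset.sum_congr rfl fun W _ => ?_
    rw [prob_Xminus_inter_Rplus_inter_SEvent, prob_Rplus_inter_SEvent_eq p ends e s T hends]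
    ring
  have hR : prob p (Rplus ends e s T) =
      ∑ W : Set V, nu p ends e s T W * (1 - kappa p ends T u w W) := by
    rw [prob_eq_sum_SEvent p ends e s]
    refine Finset.sum_congr rfl fun W _ => ?_
    rw [prob_Rplus_inter_SEvent_eq p ends e s T hends]
  -- the `e`-closed masses through the partition by `S`
  have hP0 : massP (Function.update p e 0) ends s T = ∑ W : Set V, nu p ends e s T W := by
    rw [massP_zero_eq, prob_eq_sum_SEvent p ends e s]
    rfl
  have hF : ∀ c : V, massF (Function.update p e 0) ends s {c} T =
      ∑ W : Set V, nu p ends e s T W * (if c ∈ W then 1 else 0) := by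
    intro c
    rw [massF_zero_eq, prob_eq_sum_SEvent p ends e s]
    refine Finset.sum_congr rfl fun W _ => ?_
    rw [prob_Xminus_inter_Rminus_inter_SEvent, mul_comm]
  rw [hXY, hX a, hX b, hR]
  -- set the five sums as atoms and compare the two polynomial forms
  set P := massP (Function.update p e 0) ends s T with hPdef
  set Fa := massF (Function.update p e 0) ends s {a} T with hFadef
  set Fb := massF (Function.update p e 0) ends s {b} T with hFbdef
  set N := ∑ W : Set V, nu p ends e s T W with hN
  set Nx := ∑ W : Set V, nu p ends e s T W * (if a ∈ W then 1 else 0) with hNx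
  set Ny := ∑ W : Set V, nu p ends e s T W * (if b ∈ W then 1 else 0) with hNy
  set Nxy := ∑ W : Set V, nu p ends e s T W * ((if a ∈ W then 1 else 0) * (if b ∈ W then 1 else 0))
    with hNxy
  set Kxy := ∑ W : Set V, nu p ends e s T W * ((if a ∈ W then 1 else 0) * (if b ∈ W then 1 else 0)) *
    kappa p ends T u w W with hKxy
  set Kx := ∑ W : Set V, nu p ends e s T W * (if a ∈ W then 1 else 0) * kappa p ends T u w W
    with hKx
  set Ky := ∑ W : Set V, nu p ends e s T W * (if b ∈ W then 1 else 0) * kappa p ends T u w W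
    with hKy
  set K := ∑ W : Set V, nu p ends e s T W * kappa p ends T u w W with hK
  have e1 : (∑ W : Set V, nu p ends e s T W * ((if a ∈ W then 1 else 0) * (if b ∈ W then 1 else 0)) *
      (1 - kappa p ends T u w W)) = Nxy - Kxy := by
    rw [hNxy, hKxy, ← Finset.sum_sub_distrib]
    exact Finset.sum_congr rfl fun W _ => by ring
  have e2 : (∑ W : Set V, nu p ends e s T W * (if a ∈ W then 1 else 0) *
      (1 - kappa p ends T u w W)) = Nx - Kx := by
    rw [hNx, hKx, ← Finset.sum_sub_distrib]
    exact Finset.sum_congr rfl fun W _ => by ring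
  have e3 : (∑ W : Set V, nu p ends e s T W * (if b ∈ W then 1 else 0) *
      (1 - kappa p ends T u w W)) = Ny - Ky := by
    rw [hNy, hKy, ← Finset.sum_sub_distrib]
    exact Finset.sum_congr rfl fun W _ => by ring
  have e4 : (∑ W : Set V, nu p ends e s T W * (1 - kappa p ends T u w W)) = N - K := by
    rw [hN, hK, ← Finset.sum_sub_distrib]
    exact Finset.sum_congr rfl fun W _ => by ring
  have e5 : (∑ W : Set V, nu p ends e s T W * kappa p ends T u w W *
      ((P * (if a ∈ W then 1 else 0) - Fa) * (P * (if b ∈ W then 1 else 0) - Fb))) =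
      P * P * Kxy - P * Fb * Kx - P * Fa * Ky + Fa * Fb * K := by
    rw [hKxy, hKx, hKy, hK, Finset.mul_sum, Finset.mul_sum, Finset.mul_sum, Finset.mul_sum,
      ← Finset.sum_sub_distrib, ← Finset.sum_sub_distrib, ← Finset.sum_add_distrib]
    exact Finset.sum_congr rfl fun W _ => by ring
  rw [e1, e2, e3, e4, e5]
  have hPN : P = N := hP0
  have hFaN : Fa = Nx := hF a
  have hFbN : Fb = Ny := hF b
  rw [hPN, hFaN, hFbN]
  constructor <;> intro h <;> nlinarith [h]

end Reweight


end SFrame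

end Summit.Ventures.PercRepro2
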